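import Mathlib
import Literature.NumberTheory.Sieve.Maynard2016BaseSetCount
import Literature.NumberTheory.Sieve.BrunGoldbach
import HarnessLib

/-!
# Maynard 2016: splitting the base set into residue classes modulo `P_w`

Topic `Literature/NumberTheory/Sieve`. J. Maynard, *Large gaps between primes*, Ann. of Math. (2)
183 (2016), 915–933 = arXiv:1408.5110, §6, proof of Lemma 6, display (6.6): "we first split the
sum into residue classes modulo `P_w`" — the sum over `n < U/m`, `(n(mn − 1), P_w) = 1` is the
sum over the admissible classes `a (mod P_w)` (those with `(a(ma − 1), P_w) = 1`, counted by
`card_filter_range_Pw_coprime`) of the sums over `n ≡ a (mod P_w)`; the same split is used in the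
proof of Lemma 7 ((6.23)–(6.24)). This is the entry point for adapting the tree's Maynard-2015
single-class evaluations (`MaynardSieveCounting.abs_S1_sub_main_le`,
`MaynardSieveCounting2.abs_S2_sub_main_le`, one class `v₀ (mod W)`) to the 2016 weights.

PROVED here (no named facts): the general fibrewise split of a periodic condition
(`filter_periodic_fiber_eq`, `card_filter_Icc_eq_sum_classes`, `sum_filter_Icc_eq_sum_classes`),
its specialisation to the base set (`card_baseSet_eq_sum_classes`, `sum_baseSet_eq_sum_classes`)
and the per-class count `|#{1 ≤ n ≤ N : n ≡ a (P_w)} − N/P_w| ≤ 1` re-exported in this notation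
(`abs_card_class_sub_le`).

## References

* J. Maynard, *Large gaps between primes*, Ann. of Math. (2) 183 (2016), 915–933; arXiv:1408.5110,
  §6 (6.6), (6.23)–(6.24). [Maynard2016LargeGaps]
-/

open Filter Finset
open scoped Topology

namespace Literature.NumberTheory.Sieve

namespace Maynard2016

/-- For a `P`-periodic condition `Q` and a class `a` with `Q a`: the elements of a finite set
satisfying `Q` and lying in the class `a (mod P)` are exactly its elements in the class. [cite: Maynard2016LargeGaps, §6 display (6.6)] -/
theorem filter_periodic_fiber_eq {P : ℕ} (Q : ℕ → Prop) [DecidablePred Q]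
    (hQ : Function.Periodic Q P) (s : Finset ℕ) {a : ℕ} (ha : Q a) :
    (s.filter Q).filter (fun n => n % P = a) = s.filter (fun n => n % P = a) := by
  ext n
  simp only [Finset.mem_filter]
  constructor
  · rintro ⟨⟨hs, -⟩, hn⟩
    exact ⟨hs, hn⟩
  · rintro ⟨hs, hn⟩
    refine ⟨⟨hs, ?_⟩, hn⟩
    have h1 : Q (n % P) = Q n := hQ.map_mod_nat n
    rw [hn] at h1
    exact h1 ▸ ha

/-- **Splitting into classes.** For a `P`-periodic condition `Q` (`P ≥ 1`):
`#{1 ≤ n ≤ N : Q n} = Σ_{0 ≤ a < P, Q a} #{1 ≤ n ≤ N : n ≡ a (mod P)}`. [cite: Maynard2016LargeGaps, §6 display (6.6)] -/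
theorem card_filter_Icc_eq_sum_classes {P : ℕ} (hP : 0 < P) (Q : ℕ → Prop) [DecidablePred Q]
    (hQ : Function.Periodic Q P) (N : ℕ) :
    ((Finset.Icc 1 N).filter Q).card =
      ∑ a ∈ (Finset.range P).filter Q, ((Finset.Icc 1 N).filter (fun n => n % P = a)).card := by
  have H : ∀ n ∈ (Finset.Icc 1 N).filter Q, n % P ∈ (Finset.range P).filter Q := by
    intro n hn
    rw [Finset.mem_filter] at hn ⊢
    exact ⟨Finset.mem_range.2 (Nat.mod_lt _ hP), (hQ.map_mod_nat n).mpr hn.2⟩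
  rw [Finset.card_eq_sum_card_fiberwise H]
  refine Finset.sum_congr rfl fun a ha => ?_
  rw [Finset.mem_filter, Finset.mem_range] at ha
  rw [filter_periodic_fiber_eq Q hQ _ ha.2]

/-- The same split for sums: `Σ_{1 ≤ n ≤ N, Q n} f(n) = Σ_{0 ≤ a < P, Q a} Σ_{1 ≤ n ≤ N, n ≡ a (P)} f(n)`
(`Q` `P`-periodic, `P ≥ 1`). [cite: Maynard2016LargeGaps, §6 display (6.6)] -/
theorem sum_filter_Icc_eq_sum_classes {M : Type*} [AddCommMonoid M] {P : ℕ} (hP : 0 < P)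
    (Q : ℕ → Prop) [DecidablePred Q] (hQ : Function.Periodic Q P) (N : ℕ) (f : ℕ → M) :
    ∑ n ∈ (Finset.Icc 1 N).filter Q, f n =
      ∑ a ∈ (Finset.range P).filter Q, ∑ n ∈ (Finset.Icc 1 N).filter (fun n => n % P = a), f n := by
  have H : ∀ n ∈ (Finset.Icc 1 N).filter Q, n % P ∈ (Finset.range P).filter Q := by
    intro n hn
    rw [Finset.mem_filter] at hn ⊢
    exact ⟨Finset.mem_range.2 (Nat.mod_lt _ hP), (hQ.map_mod_nat n).mpr hn.2⟩
  rw [← Finset.sum_fiberwise_of_maps_to H]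
  refine Finset.sum_congr rfl fun a ha => ?_
  rw [Finset.mem_filter, Finset.mem_range] at ha
  rw [filter_periodic_fiber_eq Q hQ _ ha.2]

/-- **(6.6) for the base set**: `#{n ≤ U/m : (n(mn − 1), P_w) = 1} =
Σ_{a (mod P_w) admissible} #{1 ≤ n ≤ ⌊U/m⌋ : n ≡ a (mod P_w)}` (`m ≥ 1`). [cite: Maynard2016LargeGaps, §6 display (6.6)] -/
theorem card_baseSet_eq_sum_classes {m : ℕ} (hm : 1 ≤ m) (C_U ε : ℝ) (x : ℕ) :
    (baseSet C_U ε x m).card =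
      ∑ a ∈ (Finset.range (Pw x)).filter (fun n => Nat.Coprime (n * (m * n - 1)) (Pw x)),
        ((Finset.Icc 1 ⌊U C_U ε x / m⌋₊).filter (fun n => n % Pw x = a)).card := by
  unfold baseSet
  exact card_filter_Icc_eq_sum_classes (primorial_pos _) _ (periodic_coprime_Pw hm x) _

/-- **(6.6) for sums over the base set**: `Σ_{n ∈ baseSet} f(n) =
Σ_{a (mod P_w) admissible} Σ_{1 ≤ n ≤ ⌊U/m⌋, n ≡ a (mod P_w)} f(n)` (`m ≥ 1`). [cite: Maynard2016LargeGaps, §6 display (6.6)] -/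
theorem sum_baseSet_eq_sum_classes {M : Type*} [AddCommMonoid M] {m : ℕ} (hm : 1 ≤ m)
    (C_U ε : ℝ) (x : ℕ) (f : ℕ → M) :
    ∑ n ∈ baseSet C_U ε x m, f n =
      ∑ a ∈ (Finset.range (Pw x)).filter (fun n => Nat.Coprime (n * (m * n - 1)) (Pw x)),
        ∑ n ∈ (Finset.Icc 1 ⌊U C_U ε x / m⌋₊).filter (fun n => n % Pw x = a), f n := by
  unfold baseSet
  exact sum_filter_Icc_eq_sum_classes (primorial_pos _) _ (periodic_coprime_Pw hm x) _ f

/-- The per-class count: `|#{1 ≤ n ≤ N : n ≡ a (mod P_w)} − N/P_w| ≤ 1` for `a < P_w`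
(`BrunGoldbach.abs_card_filter_mod_sub_le`). [cite: Maynard2016LargeGaps, §6 display (6.6)] -/
theorem abs_card_class_sub_le (N x : ℕ) {a : ℕ} (ha : a < Pw x) :
    |(((Finset.Icc 1 N).filter (fun n => n % Pw x = a)).card : ℝ) - (N : ℝ) / Pw x| ≤ 1 :=
  BrunGoldbach.abs_card_filter_mod_sub_le N ha

end Maynard2016

end Literature.NumberTheory.Sieve
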